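import Summits.Ventures.QEC.Census.BB.BB144.OrbitBZCover
import HarnessLib

/-!
# `coverAutOK = coverAutTabOK`: the two C5-with-automorphisms cover checks are the same Boolean function
# (qec PARTITION item 12.BZT, follow-up; BZ-CHECKER-SPEC §C5 / CERT-FORMAT v1.1 §5.5, L6)

`Census/BB/BB144/OrbitBZCover.lean` (type-12) defines two replays of the label cover of a `bz_aut` certificate of a
bivariate-bicycle code under translation automorphisms: the SEARCH form `coverAutOK ℓ m Ld L taus blocks` (each
probe transports a `2ℓm`-bit word and takes `k` popcounts — fine for `native_decide`, too slow for the kernel at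
`[[144,12,12]]`) and the TABULATED form `coverAutTabOK` (the `k` columns of each label action `ρ_t` computed once;
`decide +kernel` in ≈ 50 s for `BB144`, `BZAutCoverTabZ.lean`).  Both were proved SOUND separately.  This file proves
they are EQUAL AS FUNCTIONS — on every input, in range or not:

  `coverAutOK_eq_coverAutTabOK : coverAutOK ℓ m Ld L taus blocks = coverAutTabOK ℓ m Ld L taus blocks`,

so ONE kernel `decide` of the tabulated form proves the search form too (`rw [coverAutOK_eq_coverAutTabOK]`), and a
lower-bound assembly written against `coverAutOK` (type-10 `Theorems/BB144DistanceCertificateLowerZ.lean`, whose only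
`native_decide` is `coverAut_ok : coverAutOK 12 6 … = true`) can be made KERNEL by citing `BB144.coverAutOK_bb144`
(`BZAutCoverKernelZ.lean`) instead.  The proof is word-level LINEARITY: `labelWord` (popcount parities against fixed
rows), `permWord` (bit transport along ANY position map) and hence `λ ↦ probeWord … t λ` are `XOR`-linear and vanish
at `0`, and `xorSel` commutes with such maps (`xorSel (L.map g) w = g (xorSel L w)`).
HONEST FRAMING: no certificate is read and no distance value is asserted here.  Tier KERNEL, axioms standard.
-/

namespace Summit.Ventures.QEC.Census

open Literature.InformationTheory.QuantumCodes

section CoverAutEq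

/-- Popcount parities against a fixed mask are additive under `XOR`:
`popc n (d &&& (a ^^^ b)) ≡ popc n (d &&& a) + popc n (d &&& b) (mod 2)` (the `𝔽₂` inner product is bilinear). -/
theorem popc_and_xor_mod_two (n d a b : ℕ) :
    popc n (d &&& (a ^^^ b)) % 2 = (popc n (d &&& a) + popc n (d &&& b)) % 2 := by
  have h : ((popc n (d &&& (a ^^^ b)) : ℕ) : ZMod 2) = ((popc n (d &&& a) + popc n (d &&& b) : ℕ) : ZMod 2) := by
    rw [Nat.cast_add, ← ofBits_dotProduct, ← ofBits_dotProduct, ← ofBits_dotProduct, ofBits_xor, dotProduct_add]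
  exact (ZMod.natCast_eq_natCast_iff' _ _ 2).1 h

/-- **`labelWord` is `XOR`-linear**: the label of `a ⊕ b` is the `XOR` of the labels. -/
theorem labelWord_xor (n : ℕ) (Ld : List ℕ) (a b : ℕ) :
    labelWord n Ld (a ^^^ b) = labelWord n Ld a ^^^ labelWord n Ld b := by
  apply Nat.eq_of_testBit_eq
  intro i
  rw [Nat.testBit_xor, testBit_labelWord, testBit_labelWord, testBit_labelWord, popc_and_xor_mod_two]
  generalize popc n (Ld.getD i 0 &&& a) = p
  generalize popc n (Ld.getD i 0 &&& b) = q
  rw [Nat.add_mod]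
  rcases Nat.mod_two_eq_zero_or_one p with hp | hp <;> rcases Nat.mod_two_eq_zero_or_one q with hq | hq <;>
    simp [hp, hq]

/-- **`permWord` is `XOR`-linear** (for ANY position map `f`, injective or not). -/
theorem permWord_xor (f : ℕ → ℕ) (a b : ℕ) : ∀ n, permWord f (a ^^^ b) n = permWord f a n ^^^ permWord f b n
  | 0 => by simp [permWord]
  | n + 1 => by
    rw [permWord, permWord, permWord, permWord_xor f a b n, Nat.testBit_xor]
    cases a.testBit n <;> cases b.testBit n <;>
      simp [Nat.xor_assoc, Nat.xor_left_comm, Nat.xor_comm]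

/-- `xorSel` commutes with every `XOR`-linear map vanishing at `0`: `xorSel (L.map g) w = g (xorSel L w)`. -/
theorem xorSel_map_of_xor {g : ℕ → ℕ} (h0 : g 0 = 0) (hg : ∀ a b, g (a ^^^ b) = g a ^^^ g b) :
    ∀ (L : List ℕ) (w : ℕ), xorSel (L.map g) w = g (xorSel L w)
  | [], w => by simp [xorSel, h0]
  | r :: rs, w => by
    rw [List.map_cons, xorSel, xorSel, hg, xorSel_map_of_xor h0 hg rs (w / 2)]
    by_cases h : w % 2 = 1
    · simp [h]
    · simp [h, h0]

/-- **The probe word IS the tabulated probe**, as words: `probeWord ℓ m Ld L t w = xorSel (rhoCols ℓ m Ld L t) w`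
(for every `t`, in range or not). -/
theorem probeWord_eq_xorSel_rhoCols (ℓ m : ℕ) (Ld L : List ℕ) (t : ℕ × ℕ) (w : ℕ) :
    probeWord ℓ m Ld L t w = xorSel (rhoCols ℓ m Ld L t) w := by
  rw [rhoCols, xorSel_map_of_xor (g := fun lz =>
      labelWord (ℓ * m + ℓ * m) Ld (permWord (BB.translateIdx ℓ m t.1 t.2) lz (ℓ * m + ℓ * m)))
    (by rw [permWord_zero, labelWord_zero])
    (fun a b => by rw [permWord_xor, labelWord_xor])]
  rfl

/-- **`coverAutOK = coverAutTabOK`** on every input: the searching C5-with-automorphisms check and its tabulated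
form are the same Boolean function. USE: a `decide +kernel` proof of `coverAutTabOK … = true` gives
`coverAutOK … = true` by `rw [coverAutOK_eq_coverAutTabOK]` (KERNEL, no evaluation of `coverAutOK`). -/
theorem coverAutOK_eq_coverAutTabOK (ℓ m : ℕ) (Ld L : List ℕ) (taus : List (ℕ × ℕ)) (blocks : List BZBlock) :
    coverAutOK ℓ m Ld L taus blocks = coverAutTabOK ℓ m Ld L taus blocks := by
  simp only [coverAutOK, coverAutTabOK, List.any_map, Function.comp_def, probeWord_eq_xorSel_rhoCols]

/-- Smoke test: the two forms agree on a tiny instance by `rfl`-free kernel evaluation of both sides. -/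
example : coverAutOK 1 2 [3] [3] [(0, 1)] [⟨[1], []⟩] = coverAutTabOK 1 2 [3] [3] [(0, 1)] [⟨[1], []⟩] := by decide

end CoverAutEq

end Summit.Ventures.QEC.Census
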